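import Mathlib
import HarnessLib
import HarnessLib.Audit
import Summits.QuantumFields.Statement
import Literature.MathematicalPhysics.QuantumLattice.RepLieAlgebraUnitary
import Literature.MathematicalPhysics.QuantumLattice.LatticeGaugeDLRSymmetry
import Literature.MathematicalPhysics.QuantumFieldTheory.LatticeMaxwellBlockOU
import Summits.QuantumFields.YangMills.Theorems.WeakCouplingRates
import HarnessLib.Audit.Status.Attr

/-!
Route: SteinGapBootstrap

CLOSED (superseded) 2026-08-28T01:35:52Z by planner-ym-idea-4-g3-0 — reason: superseded:route-QuantumFields-ColdBoxAllGroups — superseded by route-QuantumFields-ColdBoxAllGroups — note: R380 (director-ym 01:22:44Z): closes_target WeakCouplingRates.XiPow (R2xi-G) is a tree theorem xiPow_holds (ColdBoxAllGroups, p592925) — dead target, not refuted. Owner disposition: NO RE-POINT — the Stein/free-probe discrepancy is beta^(-kappa), reach n <= beta^(kappa/8): power rates only (XiSuperP. The file is kept as the record of this route; refuted decls are indexed as negative knowledge (`ledger negatives`).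

# Route SteinGapBootstrap — The energy budget pays for Stein's generator comparison: an
unconditional free-gluon rate law gives xi >= beta^eps for every compact simple G in d = 4 (rung
leaf XiPow)

LINE for LADDER-YM rung R2ξ′ (`WeakCouplingRates.XiPow`, the ALL-G power-rate leaf; OPEN — its SU(2)
instance `XiPowSU2` is the tree theorem `xiPowSU2_holds`; an INTERMEDIATE, non-summit-bearing leaf);
no summit is proved by this line. RESTATED 2026-08-27 (revs 7–13) after the tribunal's T1 flag: the
former deciding crux K1 `SteinBlockTransferG` (gap-conditional, error polynomial in m⁻¹) is
equivalent to the leaf modulo RP plumbing and is now ASIDE; the deciding crux is its unconditional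
core U.
It suffices to show X = U (∧ provable-now supports): (U `FreeProbeLawG`) for every compact simple G,
every faithful unitary lattice representation r and every torus-limit state μ of the 4-D Wilson
theory at β ≥ β₀ that is equipartitioned (plaquette cost ≤ C₀/β — a THEOREM for limit states,
`PolySmallFieldsG`) and axis-symmetric (THEOREM, `AxisSymmetryG`), the time-covariance of the probe
exp(−2(β(N − Re tr r(U_p)))₊) at every separation n ≥ 1 is within C(1+n)^K β^(−δ) of the free-gluon
profile g_D(n) = 2^(−D)((1 − c_n²)^(−D/2) − 1), D = dim G, c_n the lattice-Maxwell plaquette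
correlation — NO clustering hypothesis, NO gap, TWO-sided. U ⇒ K1 by monotonicity (proved inline in
`closes`), and the landed `AssemblyR` (xiDiv-pattern contradiction: tree floor c_n ≥ κn⁻⁴ ⇒ g_D(2t)
≳ t⁻⁸, while a gap m > β^(−ε) forces probeCov(2t) ≤ e^(−2m(t−1))·probeCov(2); t = ⌈β^(2ε)⌉, ε(2K+16)
< δ) gives XiPow. U is split (gen 1) along Stein's seam: C1ᶠ `PairSteinDiscrepancyFreeG` (ALL the
Yang–Mills input: the pair law of the curvature coordinates (Y_0, Y_n) nearly annihilates the
lattice-Maxwell block OU generator on C² tests, at rate) → `USteinTransferPair` (Stein's lemma: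
generator discrepancy ⇒ smooth-metric closeness to the block Gaussian) → `UProbeCovFromPairLaw`
(probe covariance from pair-law closeness under equipartition); glue proved.
Lean: Summit.QuantumFields.YangMills.Theses.SteinGapBootstrap.FreeProbeLawG →
Summit.QuantumFields.YangMills.Theses.SteinGapBootstrap.GapGivesClusteringGR →
Summit.QuantumFields.YangMills.Theses.SteinGapBootstrap.PolySmallFieldsG →
Summit.QuantumFields.YangMills.Theses.SteinGapBootstrap.AxisSymmetryG →
Summit.QuantumFields.YangMills.Theses.SteinGapBootstrap.AssemblyR →
Summit.QuantumFields.YangMills.Theorems.WeakCouplingRates.XiPow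

CLOSES_TARGET: closes rung R2xi of QuantumFields: Summit.QuantumFields.YangMills.Theorems.WeakCouplingRates.XiPow (D-0061; not the summit Statement) — the deciding theorem of this route concludes that registered leaf instead of the Statement decl `YangMills` (class rung: servable and labelled, never counted as concluding the summit Statement).

Rationale: WHY THIS LINE. Mechanism (probability → constructive QFT): Stein's method of generator comparison —
the rescaled lattice Yang–Mills Langevin generator acting on functions of the plaquette 2-form Y =
√β·log U_p in a block equals the lattice-Maxwell Ornstein–Uhlenbeck generator (drift −(dd*)_B Y)
plus β^(−1/2)𝓥 + β⁻¹𝓦 (BCH), and the Schwinger–Dyson identity E_μ[𝓛 f] = 0 of limit states turns E_μ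
h(Y_B) − γ_B(h) into generator-difference terms weighted by the Stein solution
(doi:10.1214/09-AOP467 Meckes L1/L2, typed in `Literature…LatticeMaxwellBlockOU`; Chatterjee2016 /
arXiv:2511.07297 for the Maxwell leading order; arXiv:2204.12737 uses the same generator only at
STRONG coupling via Bakry–Émery). The NEW lever after the restate (the old one — "a hypothesised gap
localises the infrared" — is equivalent to the leaf, T1 2026-08-27): the ENERGY BUDGET localises the
infrared. The only obstruction to an unconditional local Gaussian law is the slowly varying harmonic
background c_R = E_μ[Y_p | links outside B_R], invisible to every local Schwinger–Dyson identity;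
but E|Y_p|² = E|Y_p − c_R|² + E|c_R|² exactly, the interior block-Dirichlet Stein comparison
(finite-dimensional; SD exact for interior links; BCH/Bianchi/comb-transport costs polynomial in R =
β^κ; large fields excluded by equipartition + Chebyshev + union bound) gives E|Y_p − c_R|² ≥ σ_R² −
β^(−δ₂), and a RATE in the free energy f_r(β) + (3D/2)log β = K_r + O(β^(−δ₁)) with convexity gives
E|Y_p|² ≤ σ_∞² + O(β^(−δ₁/2)); hence E|c_R|² ≤ β^(−δ′) and the block Gaussian law transfers to μ at
rate. This is the quantitative form of the PROVED rate-free `EquipartitionPinsProbe` (route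
EquipartitionCriticality, stmt-8760: budget 3D/2 ≥ 3D/2 + ½E|c|² ⇒ c = 0). What prior routes do not
do: WeakCouplingRates (BOX/BULK) and ColdBoxAllGroups need a cold-box two-point floor dominating the
bulk in infinite volume; EquipartitionCriticality has the law without rate and the banked xiDiv
`massGapVanishesOf_allSimpleG` gives gap → 0 without rate; EntropyBudgetEquipartition /
SourcedPressureJensen (ym-idea-3) carry the same CURRENCY for other observables (plaquette two-point
/ sourced pressure) — the shared upstream statement is the smooth-metric pair-law rate (output of
C1ᶠ + Stein's lemma), proposed as one item. ChatterjeeYMProb2019 Problem 5.1 asks for exactly such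
rates. Negatives index: none concerns weak-coupling rates, Stein identities or RP clustering.

RANKED CRUXES. #2 FreeProbeLawG (crux, XL; stmt-QuantumFields-23756) — the unconditional two-sided
rate-form probe law above (why it might fail: the free energy of 4-D lattice Yang–Mills may admit no
POWER-rate expansion beyond the (3D/2)log β term accessible without the full Bałaban machine —
Balaban's UV stability controls effective actions, not observable-level rates; a one-sided floor
version needing no rate is the recorded fallback) [doi:10.1214/09-AOP467, Chatterjee2016,
arXiv:2511.07297, ChatterjeeYMProb2019]. SPLIT (gen 1): #201 PairSteinDiscrepancyFreeG (crux, XL;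
23798) — |E_μ[(L_B F)(Y_B)]| ≤ C(1+n)^K β^(−δ)(1+M) for C² tests F with M-Lipschitz derivative on
the pair block (why it might fail: Green resummation needs ‖(dd*)_B⁻¹‖ control AND polynomial cost
of the Bianchi-defect/comb-transport parts of Y; the budget step needs the free-energy rate); #202
USteinTransferPair (support, M; 23799 ≡ SteinTransferPairG 23639) — Stein's lemma for the block OU
semigroup; #203 UProbeCovFromPairLaw (crux, M; 23800 ≡ ProbeCovFromPairLawG 23640) — probe
covariance from smooth-metric pair-law closeness under equipartition (why it might fail: the kink of
exp(−2x₊) must be smoothed at scale β^(−1/2) paying only with equipartition); #204 glue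
FreeProbeLawG_of_steinSplit (support; PROVED in planner evidence). Supports: GapGivesClusteringGR
(23209; provable now by gapGivesClusteringG_of_nonneg), PolySmallFieldsG (CLOSED), AxisSymmetryG
(CLOSED), AssemblyR (CLOSED). Asides: SteinBlockTransferG (K1, 22998; ⟸ U, ⟺ leaf mod RP plumbing),
PairSteinDiscrepancyG (23638), SteinBlockTransferG_of_steinSplit (23641), GapGivesClusteringG
(22999, misstated ∀β form), FreeProbeLawSU2 (U|(SU(2),fund): the refutable instance / tribunal
s_case).

KILL CRITERIA. (i) A limit state (any compact simple G) whose probe covariance at some fixed n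
deviates from g_D(n) by more than any power of β — e.g. lattice numerics for SU(2) at β = 2.5–3.0
showing |probeCov(n)/g_D(n) − 1| NOT decreasing in β — refutes U (and U|SU(2) first). (ii) A theorem
that 4-D lattice YM free energy has a non-power correction to (3D/2)log β kills the budget step of
C1ᶠ as planned (fallback: one-sided floor). (iii) A refutation of the Stein factor bounds for the
degenerate 2-form OU generator with growing block kills the polynomial bookkeeping.

NOT DECOMPOSED YET. C1ᶠ's interior: (a) quantitative free energy for compact simple G (the rate
input), (b) block Green kernel and Stein factors for (dd*)_B with Dirichlet exterior, (c)
small-field BCH control of 𝓥, 𝓦 on the pair block, (d) the budget identity as a Lean lemma over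
`infiniteVolumeLimitPoints`. These become the lead's stubs (skeleton `bc/birthU.lean` names the
three children; C1ᶠ's own sub-stubs are the lead's to cut).

CHEAPEST FALSIFIER. U|(SU(2), fundamental) (`FreeProbeLawSU2`, aside item): Monte-Carlo the probe
covariance at n = 1, 2 on a 16⁴ lattice at β ∈ {2.4, 2.6, 2.8} and compare with g_3(n) = 2^(−3)((1 −
c_n²)^(−3/2) − 1); a β-independent relative discrepancy kills the two-sided law (the one-sided floor
survives). In-Lean: the tribunal probes (U → XiPow, XiPow → U both unsolved; #h21_crux_probe CLEAN).

Novelty: Searches (2026-08-27): `lit search "Stein method lattice gauge"` (0 relevant), `lit search --hybrid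
"generator comparison Langevin lattice Yang-Mills weak coupling"` (→
[corpus:paper-arxiv-2204.12737], strong coupling only), `lit galaxy search "chessboard
estimate|chessboard bound" --star all` (0 gauge-theory hits), `lit galaxy search "Stein's
method|Schwinger-Dyson" --star pdf` (no weak-coupling lattice-gauge hit), galaxy bm25 "Stein method
lattice gauge theory Gaussian free field weak coupling plaquette" (0 relevant), `lit read
arxiv:2511.07297 --grep rate` (Thm 1 = U(N) leading term, no correlation transfer), `ledger
negatives --problem QuantumFields` (7, none related), `ledger route ls` (37 YM routes:
WeakCouplingRates, EquipartitionCriticality, DirichletWindow*, LangevinControlUV*, BalabanLadder*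
read).
Nearest prior art found: Chatterjee2016 / arXiv:2511.07297 Thm 1 (free energy leading term = lattice
Maxwell; no correlations, no rate); arXiv:2204.12737 (lattice YM Langevin generator, Bakry–Émery at
strong coupling); tree `EquipartitionPinsProbe_proof` (qualitative free-gluon law of the probe) and
`massGapVanishesOf_allSimpleG` (gap → 0, rate-free); route WeakCouplingRates (BOX/BULK split for the
same leaf).
Delta: a quantitative β^(−δ) free-gluon law whose infrared cost is paid by the very gap hypothesis
it refutes — Stein generator comparison localised by clustering — the first rate mechanism for ξ ≥
β^ε that never asserts infinite-volume small-field domination.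
Claim  [refs: 2511.07297, 2204.12737, paper-arxiv-2204.12737, arxiv:2511.07297, Chatterjee2016]

Barriers (technique_class: stein-generator-comparison, rp-spectral): - technique_class: stein-generator-comparison, rp-spectral
- Literature.Barriers.QuantumFields.PerturbativeInvisibility: outside — the barrier blocks
exhibiting the gap (a LOWER bound / its value) from finite-order perturbation theory; this line
proves an UPPER bound on the lattice gap (criticality at β = ∞ with a rate), which is exactly what
leading-order Gaussian comparison can see.
- Literature.Barriers.QuantumFields.StochasticQuantisationCriticality: outside — no singular-SPDE
solution theory and no continuum Langevin dynamic is used; the lattice Langevin generator enters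
only algebraically, as the Stein operator at fixed lattice spacing.
- Literature.Barriers.QuantumFields.AbelianDeconfinementD4: outside — the barrier kills group-blind
CLUSTERING (gap lower-bound) arguments in d = 4; the U(1)₄ analogue of this line's conclusion (ξ ≥
β^ε) is true (Coulomb phase), so group-blindness costs nothing for an upper bound.
- Literature.Barriers.QuantumFields.FixedCouplingUltralocality: outside — the statements are
asymptotic in β over all infinite-volume limit states, not fixed-β finite-volume numbers; the leaf
itself is ladder-declared intermediate (non-summit-bearing) and the line says so.
- Literature.Barriers.QuantumFields.MigdalKadanoffGroupBlindness: outside — no Migdal–Kadanoff /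
decimation recursion or any real-space RG approximation is used; the only `comparison` is an exact
Schwinger–Dyson identity against the lattice-Maxwell Ornstein–Uhlenbeck generator, and the conclu

History (route lifecycle, newest last):
- 2026-08-27T21:02:14Z · rev 1: restated Assembly (stmt-QuantumFields-22183) — rev 1 REPAIR per idea-crit-4 STRIKE 2026-08-27T20:46Z (dead target: XiPowSU2 = tree theorem xiPowSU2_holds): items restated uniformly over compact simple G / fa (planner-ym-idea-4-g0-0)
- 2026-08-27T21:02:14Z · rev 1: dropped SteinBlockTransfer, GapGivesClustering, PolySmallFields, AxisSymmetry — rev 1 REPAIR per idea-crit-4 STRIKE 2026-08-27T20:46Z (dead target: XiPowSU2 = tree theorem xiPowSU2_holds): items restated uniformly over compact simple G / fa (planner-ym-idea-4-g0-0)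
- 2026-08-27T21:20:37Z · closes_target -> closes rung R2xi-G of QuantumFields: Summit.QuantumFields.YangMills.Theorems.WeakCouplingRates.XiPow (D-0061; not the summit Statement) (planner-ym-idea-4-g0-0)
- 2026-08-27T21:53:52Z · closes_target -> closes rung R2xi of QuantumFields: Summit.QuantumFields.YangMills.Theorems.WeakCouplingRates.XiPow (D-0061; not the summit Statement) (planner-ym-idea-4-g0-0)
- 2026-08-27T21:53:52Z · rev 2: restated Assembly (stmt-QuantumFields-22183) — rev 1 REPAIR (re-submitted as ONE edit with the registered alt-closer): per idea-crit-4 STRIKE 20:46Z / PASS-WITH-PRICE 21:14Z — items restated uniformly over c (planner-ym-idea-4-g0-0)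
- 2026-08-27T21:53:52Z · rev 2: dropped SteinBlockTransfer, GapGivesClustering, PolySmallFields, AxisSymmetry — rev 1 REPAIR (re-submitted as ONE edit with the registered alt-closer): per idea-crit-4 STRIKE 20:46Z / PASS-WITH-PRICE 21:14Z — items restated uniformly over c (planner-ym-idea-4-g0-0)
- 2026-08-27T23:46:13Z · rev 8: dropped AssemblyU — closes re-glued PER THE TRIBUNAL J ROUND-2 RECIPE (retarget.how): closes (hU : FreeProbeLawG) (h₂ : GapGivesClusteringGR) (h₃ : PolySmallFieldsG) (h₄ : AxisSymm (planner-ym-idea-4-g2-0)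
- 2026-08-28T01:35:52Z · CLOSED superseded — superseded:route-QuantumFields-ColdBoxAllGroups (planner-ym-idea-4-g3-0)

sub-problem: YangMills · status: closed(superseded) · opened planner-ym-idea-4-g0-0 2026-08-27T20:35:43Z · rev 15 · ledger route-QuantumFields-SteinGapBootstrap
GENERATED by the gate from the ledger (D-0016/17). Provers cite these decls: `theorem foo : Summit.QuantumFields.YangMills.Theses.SteinGapBootstrap.<Decl> := …` in Summits/QuantumFields/YangMills/Theorems/<Name>.lean.
-/

namespace Summit.QuantumFields.YangMills.Theses.SteinGapBootstrap

open scoped BigOperators Topology Manifold Classical MeasureTheory ProbabilityTheory Matrix InnerProductSpace ComplexConjugate ContinuousMap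
open Filter Set Function TopologicalSpace MeasureTheory

attribute [summit_statement] _root_.YangMills
attribute [summit_statement] _root_.Summit.QuantumFields.YangMills.Theorems.WeakCouplingRates.XiPow

/-- item stmt-QuantumFields-22998 · crux · rank 2 · closed · proved by Summit.QuantumFields.YangMills.Theorems.SteinGapBootstrap.steinBlockTransferG_proof (prover) · by planner
why it might fail: Interior vertex cost β^(−1/2)Σ_(e∈B_R)|∇_e f_h| ≍ β^(−1/2)R² is fine at R = β^(1/8), but Stein factors for the DEGENERATE 2-form OU generator (gauge zero modes; non-abelian Y only approximately closed) may grow with R, and summing R³ boundary covariances may need more than pair clustering.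
sources: doi:10.1214/09-AOP467, Chatterjee2016, arXiv:2511.07297, arXiv:2204.12737, ChatterjeeYMProb2019
retired/moot children: PairSteinDiscrepancyG [moot: ∀ (G : Type) [Group G] [TopologicalSpace G] [IsTopologicalGroup G] [CompactSpace]; SteinBlockTransferG_of_steinSplit [moot: PairSteinDiscrepancyG → SteinTransferPairG → ProbeCovFromPairLawG → SteinBlockTr]
[crux] For every compact simple G, every faithful unitary lattice representation r (dimension N) and
every C₀ there are K, δ > 0, C > 0, β₀ such that for β ≥ β₀ and every torus-limit state μ ∈
infiniteVolumeLimitPoints(r.ρ, β) (formerly SU(2) fund., d = 4, β) with (i) ∫(N − Re tr r(U_p))dμ ≤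
C₀/β at every plaquette, (ii) invariance of μ on bounded continuous cylinder observables under every
axis permutation `relabelConfig (edgePerm σ)`, and (iii) for some m > 0 the pair clustering
|Cov_μ(A∘θ, B∘τ_t)| ≤ 2e^(−mt)·a·b for all positive-time observables A, B bounded by a, b: for every
n ≥ 1 the probe time-covariance at separation n is within C(1 + m⁻¹ + n)^K β^(−δ) of g_D(n).
[difficulty: XL] -/
@[route_item "route-QuantumFields-SteinGapBootstrap"]
def SteinBlockTransferG : Prop :=
  ∀ (G : Type) [Group G] [TopologicalSpace G] [IsTopologicalGroup G] [CompactSpace G], Literature.MathematicalPhysics.QuantumFieldTheory.IsCompactSimpleLieGroup G → letI : MeasurableSpace G := borel G; haveI : BorelSpace G := ⟨rfl⟩; ∀ r : Literature.MathematicalPhysics.QuantumFieldTheory.LatticeRep G, ∀ C₀ : ℝ, ∃ (K δ C β₀ : ℝ), 0 < δ ∧ 0 < C ∧ ∀ β : ℝ, β₀ ≤ β → ∀ μ ∈ Literature.MathematicalPhysics.QuantumLattice.infiniteVolumeLimitPoints (d := 4) r.ρ β, (∀ (x : Literature.Probability.LatticeModels.Site 4) (i j : Fin 4), i ≠ j →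 ∫ U, ((r.N : ℝ) - Literature.MathematicalPhysics.QuantumLattice.plaquetteObs r.ρ x i j U) ∂μ ≤ C₀ / β) → (∀ (σ : Equiv.Perm (Fin 4)) (F : Literature.MathematicalPhysics.QuantumLattice.LGConfig 4 (G) → ℝ) (S : Finset (Literature.MathematicalPhysics.QuantumLattice.ZdEdge 4)), Literature.MathematicalPhysics.QuantumLattice.IsCylinder F S → Continuous F → (∃ C, ∀ U, |F U| ≤ C) → ∫ U, F (Literature.MathematicalPhysics.QuantumLattice.relabelConfig (Literature.MathematicalPhysics.QuantumLattice.edgePerm σ) U) ∂μ = ∫ U, F U ∂μ) → ∀ m : ℝ, 0 < m → (∀ (A B : Literature.MathematicalPhysics.QuantumLattice.LGConfig 4 (G) → ℝ), Summit.QuantumFields.YangMills.Theorems.WeakCouplingRates.IsPosTimeObs A → Summit.QuantumFields.YangMills.Theorems.WeakCouplingRates.IsPosTimeObs B → ∀ a b : ℝ, (∀ U, |A U| ≤ a) → (∀ U, |B U| ≤ b) → ∀ t : ℕ, |(∫ U, A (Summit.QuantumFields.YangMills.Theorems.WeakCouplingRates.timeReflectLG U) * B (Summit.QuantumFields.YangMills.Theorems.WeakCouplingRates.timeShiftLG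 (G := G) t U) ∂μ) - (∫ U, A (Summit.QuantumFields.YangMills.Theorems.WeakCouplingRates.timeReflectLG U) ∂μ) * (∫ U, B (Summit.QuantumFields.YangMills.Theorems.WeakCouplingRates.timeShiftLG (G := G) t U) ∂μ)| ≤ 2 * Real.exp (-(m * t)) * a * b) → ∀ n : ℕ, 1 ≤ n → let P : Literature.MathematicalPhysics.QuantumLattice.LGConfig 4 (G) → ℝ := fun U => Real.exp (-2 * max (β * ((r.N : ℝ) - Literature.MathematicalPhysics.QuantumLattice.plaquetteObs r.ρ 0 1 2 U)) 0); let D : ℝ := (Module.finrank ℝ ↥(Submodule.span ℝ {X : Matrix (Fin r.N) (Fin r.N) ℂ | ∀ t : ℝ, NormedSpace.exp ((t : ℂ) • X) ∈ Set.range r.ρ}) : ℝ); let c₂ : ℝ := Literature.MathematicalPhysics.QuantumFieldTheory.curvaturePlaquetteCorr (d := 4) (by norm_num) (n : ℤ); |((∫ U, P U * P (Summit.QuantumFields.YangMills.Theorems.WeakCouplingRates.timeShiftLG (G := G) n U) ∂μ) - (∫ U, P U ∂μ) * (∫ U, P (Summit.QuantumFields.YangMills.Theorems.WeakCouplingRates.timeShiftLG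 (G := G) n U) ∂μ)) - (2 : ℝ) ^ (-D) * ((1 - c₂ ^ 2) ^ (-(D / 2)) - 1)| ≤ C * (1 + m⁻¹ + n) ^ K * β ^ (-δ)

-- `SteinBlockTransferG` holds: proved by `Summit.QuantumFields.YangMills.Theorems.SteinGapBootstrap.steinBlockTransferG_proof` (its module imports this route file, so no `_holds` link can be stated here).

-- parent: SteinBlockTransferG · child (gen 1)
/--     item stmt-QuantumFields-23640 · crux · rank 203 · closed · proved by Summit.QuantumFields.YangMills.Theorems.SteinGapBootstrap.probeCovFromPairLawG_proof (prover)
    parent: SteinBlockTransferG · by planner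
    why it might fail: The fourth-order chart remainder O(|Y|⁴/β) is controlled only through second moments (equipartition) plus the trivial bound |Y| ≤ C√β; the Chebyshev truncation must still leave a positive power δ — fails if the tail-times-bound trade gives exponent 0.
    sources: arXiv:1602.01222, arXiv:2107.04021, arXiv:0902.0333
[crux] PROBE COVARIANCE FROM THE PAIR LAW, UNDER EQUIPARTITION. For every compact simple G, faithful
unitary r and C₀ there are δ, C > 0, β₀ such that for β ≥ β₀, every limit state μ with equipartition
≤ C₀/β, every n ≥ 1 and η ≥ 0: if |E_μ h(Y^β_B) − γ_B(h)| ≤ η for all smooth h with ‖∇h‖ ≤ 1, ‖∇²h‖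
≤ 1 on the pair block, then the probe time-covariance at separation n is within Cη + Cβ^(−δ) of
g_D(n) = 2^(−D)((1 − c_n²)^(−D/2) − 1) (conclusion verbatim as in `SteinBlockTransferG`). Content:
in the comb gauge the plaquette₁₂ holonomy at an e₀-axis site sits on ONE non-comb link, so β(N − Re
tr ρ(U_p)) = ½β‖ρ(Ũ_e) − 1‖²_HS = ½|Y^β_p|² + O(|Y^β_p|⁴/β) (proj_𝔤 of the Hermitian square
vanishes), whence |P − e^(−|Y_p|²)| is polynomially small off a Chebyshev tail controlled by (i);
the Gaussian side E_γ e^(−|Y_0|²)e^(−|Y_n|²) − (E_γ e^(−|Y_0|²))² is the closed form g_D(n) (tree: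
`equipartitionPinsProbe_of_localLaw`); test functions e^(−|y_0|²−|y_n|²)/c have bounded C² norm;
`timeShiftLG n` vs `configShift (−n e₀)` by translation invariance of limit states. -/
@[route_item "route-QuantumFields-SteinGapBootstrap"]
def ProbeCovFromPairLawG : Prop :=
  ∀ (G : Type) [Group G] [TopologicalSpace G] [IsTopologicalGroup G] [CompactSpace G], Literature.MathematicalPhysics.QuantumFieldTheory.IsCompactSimpleLieGroup G → letI : MeasurableSpace G := borel G; haveI : BorelSpace G := ⟨rfl⟩; ∀ r : Literature.MathematicalPhysics.QuantumFieldTheory.LatticeRep G, ∀ C₀ : ℝ, ∃ (δ C β₀ : ℝ), 0 < δ ∧ 0 < C ∧ ∀ β : ℝ, β₀ ≤ β → ∀ μ ∈ Literature.MathematicalPhysics.QuantumLattice.infiniteVolumeLimitPoints (d := 4) r.ρ β, (∀ (x : Literature.Probability.LatticeModels.Site 4) (i j : Fin 4), i ≠ j → ∫ U, ((r.N : ℝ) - Literature.MathematicalPhysics.QuantumLattice.plaquetteObs r.ρ x i j U) ∂μ ≤ C₀ / β) → ∀ n : ℕ, 1 ≤ n → ∀ η : ℝ, 0 ≤ η →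 let B : Finset (Literature.MathematicalPhysics.QuantumLattice.ZdPlaquette 4) := {Literature.MathematicalPhysics.QuantumFieldTheory.plaquette12 (d := 4) (by norm_num) 0, Literature.MathematicalPhysics.QuantumFieldTheory.plaquette12 (d := 4) (by norm_num) (Pi.single (0 : Fin 4) (n : ℤ))}; let YB : Literature.MathematicalPhysics.QuantumLattice.LGConfig 4 (G) → (↥B → Fin (Summit.QuantumFields.YangMills.Theorems.EquipartitionPinsProbe.lieDim r) → ℝ) := fun U p a => Summit.QuantumFields.YangMills.Theorems.EquipartitionPinsProbe.plaqField r β U (p : Literature.MathematicalPhysics.QuantumLattice.ZdPlaquette 4) a; (∀ (h : (↥B → Fin (Summit.QuantumFields.YangMills.Theorems.EquipartitionPinsProbe.lieDim r) → ℝ) → ℝ), ContDiff ℝ (⊤ : ℕ∞) h → (∀ x, ‖fderiv ℝ h x‖ ≤ 1) → (∀ x, ‖iteratedFDeriv ℝ 2 h x‖ ≤ 1) → |(∫ U, h (YB U) ∂μ) - ∫ z, h z ∂(Literature.MathematicalPhysics.QuantumFieldTheory.latticeMaxwellBlockLaw B (Summit.QuantumFields.YangMills.Theorems.EquipartitionPinsProbe.lieDim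 r))| ≤ η) → let P : Literature.MathematicalPhysics.QuantumLattice.LGConfig 4 (G) → ℝ := fun U => Real.exp (-2 * max (β * ((r.N : ℝ) - Literature.MathematicalPhysics.QuantumLattice.plaquetteObs r.ρ 0 1 2 U)) 0); let D : ℝ := (Module.finrank ℝ ↥(Submodule.span ℝ {X : Matrix (Fin r.N) (Fin r.N) ℂ | ∀ t : ℝ, NormedSpace.exp ((t : ℂ) • X) ∈ Set.range r.ρ}) : ℝ); let c₂ : ℝ := Literature.MathematicalPhysics.QuantumFieldTheory.curvaturePlaquetteCorr (d := 4) (by norm_num) (n : ℤ); |((∫ U, P U * P (Summit.QuantumFields.YangMills.Theorems.WeakCouplingRates.timeShiftLG (G := G) n U) ∂μ) - (∫ U, P U ∂μ) * (∫ U, P (Summit.QuantumFields.YangMills.Theorems.WeakCouplingRates.timeShiftLG (G := G) n U) ∂μ)) - (2 : ℝ) ^ (-D) * ((1 - c₂ ^ 2) ^ (-(D / 2)) - 1)| ≤ C * η + C * β ^ (-δ)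

-- `ProbeCovFromPairLawG` holds: proved by `Summit.QuantumFields.YangMills.Theorems.SteinGapBootstrap.probeCovFromPairLawG_proof` (its module imports this route file, so no `_holds` link can be stated here).

-- parent: SteinBlockTransferG · child (gen 1)
/--     item stmt-QuantumFields-23639 · support · rank 202 · closed · proved by Summit.QuantumFields.YangMills.Theorems.SteinGapBootstrap.SteinTransferPairG_proof (prover)
    parent: SteinBlockTransferG · by planner
    why it might fail: Not expected to fail (Stein's lemma); only the C²-regularity of U_o h for smooth h (differentiation under the Mehler integral twice) is not yet in the tree.
    sources: arXiv:0902.0333, arXiv:math/0701464, Barbour1990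
[support] STEIN'S LEMMA FOR THE LATTICE-MAXWELL PAIR-BLOCK LAW (pure Gaussian analysis over the
landed `LatticeMaxwellBlockOU`). For every G, r, β, limit state μ, n ≥ 1 and ε ≥ 0: if |E_μ[(L_B
F)(Y^β_B)]| ≤ ε(1 + M) for all C² F with ‖∇F‖ ≤ 1 and M-Lipschitz gradient, then |E_μ h(Y^β_B) −
γ_B(h)| ≤ 2ε for every smooth h with ‖∇h‖ ≤ 1, ‖∇²h‖ ≤ 1 (γ_B = `latticeMaxwellBlockLaw B D`).
Proof: F := −U_o h (`latticeMaxwellBlockStein`) solves L_B F = h − γ_B h pointwise (Meckes 2009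
Lemma 1 (3) — the named fact `Meckes2009_lemma1_steinEquation_latticeMaxwellBlock`, to be proved or
taken) and has ‖∇F‖ ≤ 1, ∇F ½-Lipschitz (landed Stein factors
`lipschitzWith_latticeMaxwellBlockStein`,
`Meckes2009_lemma2_hessianSteinFactor_latticeMaxwellBlock_holds`), so the hypothesis with M = ½
gives 3ε/2 ≤ 2ε; μ is a probability measure (limit point). -/
@[route_item "route-QuantumFields-SteinGapBootstrap"]
def SteinTransferPairG : Prop :=
  ∀ (G : Type) [Group G] [TopologicalSpace G] [IsTopologicalGroup G] [CompactSpace G], Literature.MathematicalPhysics.QuantumFieldTheory.IsCompactSimpleLieGroup G → letI : MeasurableSpace G := borel G; haveI : BorelSpace G := ⟨rfl⟩; ∀ r : Literature.MathematicalPhysics.QuantumFieldTheory.LatticeRep G, ∀ β : ℝ, ∀ μ ∈ Literature.MathematicalPhysics.QuantumLattice.infiniteVolumeLimitPoints (d := 4) r.ρ β, ∀ n : ℕ, 1 ≤ n → ∀ ε : ℝ, 0 ≤ ε → let B : Finset (Literature.MathematicalPhysics.QuantumLattice.ZdPlaquette 4) := {Literature.MathematicalPhysics.QuantumFieldTheory.plaquette12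 (d := 4) (by norm_num) 0, Literature.MathematicalPhysics.QuantumFieldTheory.plaquette12 (d := 4) (by norm_num) (Pi.single (0 : Fin 4) (n : ℤ))}; let YB : Literature.MathematicalPhysics.QuantumLattice.LGConfig 4 (G) → (↥B → Fin (Summit.QuantumFields.YangMills.Theorems.EquipartitionPinsProbe.lieDim r) → ℝ) := fun U p a => Summit.QuantumFields.YangMills.Theorems.EquipartitionPinsProbe.plaqField r β U (p : Literature.MathematicalPhysics.QuantumLattice.ZdPlaquette 4) a; (∀ (F : (↥B → Fin (Summit.QuantumFields.YangMills.Theorems.EquipartitionPinsProbe.lieDim r) → ℝ) → ℝ) (M : ℝ), 0 ≤ M → ContDiff ℝ 2 F → (∀ x, ‖fderiv ℝ F x‖ ≤ 1) → (∀ x y, ‖fderiv ℝ F x - fderiv ℝ F y‖ ≤ M * ‖x - y‖) → |∫ U, Literature.MathematicalPhysics.QuantumFieldTheory.latticeMaxwellBlockGenerator B (Summit.QuantumFields.YangMills.Theorems.EquipartitionPinsProbe.lieDim r) F (YB U) ∂μ| ≤ ε * (1 + M)) → ∀ (h : (↥B → Fin (Summit.QuantumFields.YangMills.Theorems.EquipartitionPinsProbe.lieDim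 r) → ℝ) → ℝ), ContDiff ℝ (⊤ : ℕ∞) h → (∀ x, ‖fderiv ℝ h x‖ ≤ 1) → (∀ x, ‖iteratedFDeriv ℝ 2 h x‖ ≤ 1) → |(∫ U, h (YB U) ∂μ) - ∫ z, h z ∂(Literature.MathematicalPhysics.QuantumFieldTheory.latticeMaxwellBlockLaw B (Summit.QuantumFields.YangMills.Theorems.EquipartitionPinsProbe.lieDim r))| ≤ 2 * ε

-- `SteinTransferPairG` holds: proved by `Summit.QuantumFields.YangMills.Theorems.SteinGapBootstrap.SteinTransferPairG_proof` (its module imports this route file, so no `_holds` link can be stated here).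

/-- item stmt-QuantumFields-23756 · crux · rank 2 · closed · moot by None · by planner
why it might fail: Needs a RATE f_r(β) + (3D/2)log β − K_r = O(β^(−δ₁)) for every compact simple G (only o(1) is in the tree) plus an interior block-Dirichlet Stein comparison uniform over typical boundary data; the IR harmonic background is bounded only in L² by the energy budget — δ may degrade to 0 with D.
sources: arXiv:1602.01222, arXiv:2511.07297, arXiv:0902.0333, doi:10.1214/09-AOP467, GarbanSepulveda2023, SeilerLNP1982
[crux] U — UNCONDITIONAL RATE-FORM FREE-GLUON PROBE LAW (K1 `SteinBlockTransferG` with hypothesis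
(iii) and the m-dependence deleted, per tribunal T1 flag 2026-08-27T22:48:58Z). For every compact
simple G, faithful unitary r and C₀ there are K, δ, C > 0, β₀ such that for β ≥ β₀, every
torus-limit state μ that is (i) equipartitioned (E_μ(N − Re tr r(U_p)) ≤ C₀/β) and (ii)
axis-symmetric, and every n ≥ 1: |Cov_μ(P, P∘τ_{n e₀}) − g_D(n)| ≤ C(1+n)^K β^(−δ), P = exp(−2(β(N −
Re tr r(U_p)))₊) at the (1,2)-plaquette of the origin, g_D(n) = 2^(−D)((1 − c_n²)^(−D/2) − 1), D =
dim G, c_n = curvaturePlaquetteCorr n. Rate version of the PROVED rate-free `EquipartitionPinsProbe`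
(stmt-8760); same currency as EBE/SPJ. Proof plan (Stein line, no clustering): quantitative free
energy (rate) ⇒ sharp equipartition at rate ⇒ harmonic-background budget E|E[Y_p | exterior of
B_R]|² ≤ β^(−δ'); interior block-Dirichlet Schwinger–Dyson/Stein comparison (finite-dimensional,
polynomial losses, R = β^κ); Stein's lemma for the lattice-Maxwell pair law (child
SteinTransferPairG 23639, verbatim); probe from pair law under equipartition (child
ProbeCovFromPairLawG 23640, verbatim). -/
@[route_item "route-QuantumFields-SteinGapBootstrap", crux]
def FreeProbeLawG : Prop :=
  ∀ (G : Type) [Group G] [TopologicalSpace G] [IsTopologicalGroup G] [CompactSpace G], Literature.MathematicalPhysics.QuantumFieldTheory.IsCompactSimpleLieGroup G → letI : MeasurableSpace G := borel G; haveI : BorelSpace G := ⟨rfl⟩; ∀ r : Literature.MathematicalPhysics.QuantumFieldTheory.LatticeRep G, ∀ C₀ : ℝ, ∃ (K δ C β₀ : ℝ), 0 < δ ∧ 0 < C ∧ ∀ β : ℝ, β₀ ≤ β → ∀ μ ∈ Literature.MathematicalPhysics.QuantumLattice.infiniteVolumeLimitPoints (d := 4) r.ρ β, (∀ (x : Literature.Probability.LatticeModels.Site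 4) (i j : Fin 4), i ≠ j → ∫ U, ((r.N : ℝ) - Literature.MathematicalPhysics.QuantumLattice.plaquetteObs r.ρ x i j U) ∂μ ≤ C₀ / β) → (∀ (σ : Equiv.Perm (Fin 4)) (F : Literature.MathematicalPhysics.QuantumLattice.LGConfig 4 (G) → ℝ) (S : Finset (Literature.MathematicalPhysics.QuantumLattice.ZdEdge 4)), Literature.MathematicalPhysics.QuantumLattice.IsCylinder F S → Continuous F → (∃ C, ∀ U, |F U| ≤ C) → ∫ U, F (Literature.MathematicalPhysics.QuantumLattice.relabelConfig (Literature.MathematicalPhysics.QuantumLattice.edgePerm σ) U) ∂μ = ∫ U, F U ∂μ) → ∀ n : ℕ, 1 ≤ n → let P : Literature.MathematicalPhysics.QuantumLattice.LGConfig 4 (G) → ℝ := fun U => Real.exp (-2 * max (β * ((r.N : ℝ) - Literature.MathematicalPhysics.QuantumLattice.plaquetteObs r.ρ 0 1 2 U)) 0); let D : ℝ := (Module.finrank ℝ ↥(Submodule.span ℝ {X : Matrix (Fin r.N) (Fin r.N) ℂ | ∀ t : ℝ, NormedSpace.exp ((t : ℂ) • X) ∈ Set.range r.ρ}) : ℝ);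 let c₂ : ℝ := Literature.MathematicalPhysics.QuantumFieldTheory.curvaturePlaquetteCorr (d := 4) (by norm_num) (n : ℤ); |((∫ U, P U * P (Summit.QuantumFields.YangMills.Theorems.WeakCouplingRates.timeShiftLG (G := G) n U) ∂μ) - (∫ U, P U ∂μ) * (∫ U, P (Summit.QuantumFields.YangMills.Theorems.WeakCouplingRates.timeShiftLG (G := G) n U) ∂μ)) - (2 : ℝ) ^ (-D) * ((1 - c₂ ^ 2) ^ (-(D / 2)) - 1)| ≤ C * (1 + (n : ℝ)) ^ K * β ^ (-δ)

-- parent: FreeProbeLawG · child (gen 1)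
/--     item stmt-QuantumFields-23798 · crux · rank 201 · closed · moot by None
    parent: FreeProbeLawG · by planner
    why it might fail: Input (a), the free-energy RATE, is a tree theorem (FreeEnergyRate_of). Load (b): interior block-Dirichlet Stein comparison UNIFORM over typical exterior data with an L²-only background budget — δ may degrade to 0 if Green/Stein factors of (dd*)_B grow with R = β^κ or Bianchi/comb parts cost more.
    sources: doi:10.1214/09-AOP467, arXiv:1602.01222, arXiv:2511.07297, Summit.QuantumFields.YangMills.Theorems.FreeEnergyRate.FreeEnergyRate_of
[crux] m-FREE APPROXIMATE GAUSSIAN STEIN IDENTITY OF THE PAIR PLAQUETTE FIELD (child C1ᶠ of U =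
PairSteinDiscrepancyG with the all-axes clustering hypothesis and the m-dependence deleted). For
every compact simple G, faithful unitary r and C₀ there are K, δ, C > 0, β₀ such that for β ≥ β₀,
every torus-limit state μ with equipartition ≤ C₀/β, every n ≥ 1 and every C² test function F on the
pair block B = {plaquette₁₂(0), plaquette₁₂(n e₀)} with ‖∇F‖ ≤ 1 and M-Lipschitz gradient: |E_μ[(L_B
F)(Y^β_B)]| ≤ C(1+n)^K β^(−δ)(1+M), L_B = latticeMaxwellBlockGenerator B (lieDim r), Y^β = plaqField
r β. This is where ALL Yang–Mills input of U lives. Proof plan WITHOUT clustering: (a) QUANTITATIVE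
FREE ENERGY f_r(β) + (3D/2) log β = K_r + O(β^(−δ₁)) (rate version of the closed
FreeEnergyLogCoefficient; Chatterjee's comparison is effective) + convexity ⇒ sharp equipartition
E_μ|Y_p|² ≤ σ_∞² + O(β^(−δ₁/2)); (b) INTERIOR BLOCK-DIRICHLET STEIN on B_R, R = β^κ: one-link
Schwinger–Dyson identities are exact for interior links under the DLR kernel, BCH/Bianchi
linearisation at polynomial cost on the event {all |Y_q| ≤ β^(κ'), q ∈ B_R} (complement has μ-mass ≤
C R⁴ β^(−2κ') by equipartition + Chebyshev -/
@[route_item "route-QuantumFields-SteinGapBootstrap"]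
def PairSteinDiscrepancyFreeG : Prop :=
  ∀ (G : Type) [Group G] [TopologicalSpace G] [IsTopologicalGroup G] [CompactSpace G], Literature.MathematicalPhysics.QuantumFieldTheory.IsCompactSimpleLieGroup G → letI : MeasurableSpace G := borel G; haveI : BorelSpace G := ⟨rfl⟩; ∀ r : Literature.MathematicalPhysics.QuantumFieldTheory.LatticeRep G, ∀ C₀ : ℝ, ∃ (K δ C β₀ : ℝ), 0 < δ ∧ 0 < C ∧ ∀ β : ℝ, β₀ ≤ β → ∀ μ ∈ Literature.MathematicalPhysics.QuantumLattice.infiniteVolumeLimitPoints (d := 4) r.ρ β, (∀ (x : Literature.Probability.LatticeModels.Site 4) (i j : Fin 4), i ≠ j → ∫ U, ((r.N : ℝ) - Literature.MathematicalPhysics.QuantumLattice.plaquetteObs r.ρ x i j U) ∂μ ≤ C₀ / β) → ∀ n : ℕ, 1 ≤ n → let B : Finset (Literature.MathematicalPhysics.QuantumLattice.ZdPlaquette 4) := {Literature.MathematicalPhysics.QuantumFieldTheory.plaquette12 (d := 4) (by norm_num) 0, Literature.MathematicalPhysics.QuantumFieldTheory.plaquette12 (d := 4) (by norm_num) (Pi.single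 (0 : Fin 4) (n : ℤ))}; let YB : Literature.MathematicalPhysics.QuantumLattice.LGConfig 4 (G) → (↥B → Fin (Summit.QuantumFields.YangMills.Theorems.EquipartitionPinsProbe.lieDim r) → ℝ) := fun U p a => Summit.QuantumFields.YangMills.Theorems.EquipartitionPinsProbe.plaqField r β U (p : Literature.MathematicalPhysics.QuantumLattice.ZdPlaquette 4) a; ∀ (F : (↥B → Fin (Summit.QuantumFields.YangMills.Theorems.EquipartitionPinsProbe.lieDim r) → ℝ) → ℝ) (M : ℝ), 0 ≤ M → ContDiff ℝ 2 F → (∀ x, ‖fderiv ℝ F x‖ ≤ 1) → (∀ x y, ‖fderiv ℝ F x - fderiv ℝ F y‖ ≤ M * ‖x - y‖) → |∫ U, Literature.MathematicalPhysics.QuantumFieldTheory.latticeMaxwellBlockGenerator B (Summit.QuantumFields.YangMills.Theorems.EquipartitionPinsProbe.lieDim r) F (YB U) ∂μ| ≤ C * (1 + (n : ℝ)) ^ K * β ^ (-δ) * (1 + M)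

-- parent: FreeProbeLawG · child (gen 1)
/--     item stmt-QuantumFields-23800 · crux · rank 203 · closed · proved by Summit.QuantumFields.YangMills.Theorems.SteinGapBootstrap.uProbeCovFromPairLaw_proof (prover)
    parent: FreeProbeLawG · by planner
    why it might fail: The kink of x ↦ exp(−2x₊) at 0 costs a smoothing error that must be paid at rate β^(−δ′) using only the equipartition bound (no density for μ∘Y⁻¹ is known); a hidden n-dependence of the Gaussian side would break the (1+n)^K bookkeeping.
    sources: SeilerLNP1982, arXiv:1602.01222
[crux] REUSE of the existing item ProbeCovFromPairLawG (stmt-QuantumFields-23640, K1's m-free gen-1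
child) as U's child: the statement IS that decl (alias), so the two items close together (`exact`).
Content: from smooth-metric closeness η of the pair law of (Y_0, Y_n) to the block Gaussian γ_B and
equipartition (plaquette-cost means ≤ C₀/β), the exponential probe covariance is g_D(n) up to C′(η +
β^(−δ′))(1+n)^0: smoothing of P = exp(−2(·)₊) at scale β^(−1/2), Gaussian evaluation of the probe
under γ_B (tree: probe law of the curvature Gaussian field, curvaturePlaquetteCorr), tail control by
equipartition + Chebyshev. -/
@[route_item "route-QuantumFields-SteinGapBootstrap"]
def UProbeCovFromPairLaw : Prop :=
  Summit.QuantumFields.YangMills.Theses.SteinGapBootstrap.ProbeCovFromPairLawG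

-- `UProbeCovFromPairLaw` holds: proved by `Summit.QuantumFields.YangMills.Theorems.SteinGapBootstrap.uProbeCovFromPairLaw_proof` (its module imports this route file, so no `_holds` link can be stated here).

-- parent: FreeProbeLawG · child (gen 1)
/--     item stmt-QuantumFields-23799 · support · rank 202 · closed · proved by Summit.QuantumFields.YangMills.Theorems.SteinGapBootstrap.USteinTransferPair_proof (prover)
    parent: FreeProbeLawG · by planner
    why it might fail: Not expected to fail (Stein's lemma); only the C²-regularity of the Stein solution U_o h for smooth h (differentiating twice under the Mehler formula) is not yet in the tree.
    sources: doi:10.1214/09-AOP467, arXiv:0902.0333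
[support] REUSE of the existing item SteinTransferPairG (stmt-QuantumFields-23639, K1's m-free gen-1
child) as U's child: the statement IS that decl (alias), so the two items close together (`exact`).
Content: Stein's lemma for the lattice-Maxwell block OU semigroup (Meckes 2009 L1/L2; tree:
latticeMaxwellBlockStein, lipschitzWith_latticeMaxwellBlockStein, Meckes2009_lemma2_…_holds):
generator discrepancy ε on C² test functions with Lipschitz derivative ⇒ |E_μ h(Y_B) − γ_B(h)| ≤ 2ε
for smooth 1-Lipschitz h. -/
@[route_item "route-QuantumFields-SteinGapBootstrap"]
def USteinTransferPair : Prop :=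
  Summit.QuantumFields.YangMills.Theses.SteinGapBootstrap.SteinTransferPairG

-- `USteinTransferPair` holds: proved by `Summit.QuantumFields.YangMills.Theorems.SteinGapBootstrap.USteinTransferPair_proof` (its module imports this route file, so no `_holds` link can be stated here).

-- parent: FreeProbeLawG · glue (gen 1)
/--     item stmt-QuantumFields-23801 · support · rank 204 · closed · proved by Summit.QuantumFields.YangMills.Theorems.SteinGapBootstrap.freeProbeLawG_of_steinSplit_proof (prover)
    parent: FreeProbeLawG · GLUE: children ⟹ parent · by planner
Stein seam, m-free: PairSteinDiscrepancyFreeG (ε = C(1+n)^K β^(−δ): smooth-test discrepancy of the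
YM pair law against the lattice-Maxwell block OU generator) → USteinTransferPair (alias of
SteinTransferPairG 23639: Stein lemma, discrepancy ⇒ smooth-metric closeness 2ε of the pair law to
the block Gaussian γ_B) → UProbeCovFromPairLaw (alias of ProbeCovFromPairLawG 23640: probe
covariance from pair-law closeness under equipartition, η := 2ε) → FreeProbeLawG; constants K ↦ max
K 0, δ ↦ min δ δ′, C ↦ 2CC′+C′, β₀ ↦ max (max β₀ β₀′) 1; PROVED in planner Sketch3.lean, theorem
freeProbeLawG_of_split (lean check rc 0, 0 sorries, axioms propext/Classical.choice/Quot.sound; the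
aliases unfold by defeq) — attached as evidence -/
@[route_item "route-QuantumFields-SteinGapBootstrap"]
def FreeProbeLawG_of_steinSplit : Prop :=
  PairSteinDiscrepancyFreeG → USteinTransferPair → UProbeCovFromPairLaw → FreeProbeLawG

-- `FreeProbeLawG_of_steinSplit` holds: proved by `Summit.QuantumFields.YangMills.Theorems.SteinGapBootstrap.freeProbeLawG_of_steinSplit_proof` (its module imports this route file, so no `_holds` link can be stated here).

/-- item stmt-QuantumFields-22999 · aside · rank 3 · closed · moot by None · by planner
why it might fail: `HasRPTimeGap` bounds only the diagonal form Q_t(F) ≤ e^(−mt)Q_0(F); the off-diagonal bound needs Q_t ≥ 0, i.e. reflection positivity of μ itself, which for limit points along odd or mixed-parity tori L_k+1 is not in the tree (EquipartitionCriticality needed an odd-torus Hankel workaround).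
sources: OsterwalderSeilerAnnPhys1978, BorgsSeiler1983, SeilerLNP1982
[crux] For every compact simple G, faithful unitary r, every β, every torus-limit state μ (d = 4)
and every m with `HasRPTimeGap μ m`: for all positive-time observables A, B (`IsPosTimeObs`) bounded
by a, b and every t ∈ ℕ, |∫A(θU)B(τ_t U)dμ − ∫A∘θ dμ ∫B∘τ_t dμ| ≤ 2e^(−mt)·a·b (off-diagonal
spectral bound: polarisation of the RP form plus Cauchy–Schwarz at time 0). [difficulty: M] -/
@[route_item "route-QuantumFields-SteinGapBootstrap"]
def GapGivesClusteringG : Prop :=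
  ∀ (G : Type) [Group G] [TopologicalSpace G] [IsTopologicalGroup G] [CompactSpace G], Literature.MathematicalPhysics.QuantumFieldTheory.IsCompactSimpleLieGroup G → letI : MeasurableSpace G := borel G; haveI : BorelSpace G := ⟨rfl⟩; ∀ r : Literature.MathematicalPhysics.QuantumFieldTheory.LatticeRep G, ∀ β : ℝ, ∀ μ ∈ Literature.MathematicalPhysics.QuantumLattice.infiniteVolumeLimitPoints (d := 4) r.ρ β, ∀ m : ℝ, Summit.QuantumFields.YangMills.Theorems.WeakCouplingRates.HasRPTimeGap μ m → ∀ (A B : Literature.MathematicalPhysics.QuantumLattice.LGConfig 4 (G) → ℝ), Summit.QuantumFields.YangMills.Theorems.WeakCouplingRates.IsPosTimeObs A → Summit.QuantumFields.YangMills.Theorems.WeakCouplingRates.IsPosTimeObs B → ∀ a b : ℝ, (∀ U, |A U| ≤ a) → (∀ U, |B U| ≤ b) → ∀ t : ℕ, |(∫ U, A (Summit.QuantumFields.YangMills.Theorems.WeakCouplingRates.timeReflectLG U) * B (Summit.QuantumFields.YangMills.Theorems.WeakCouplingRates.timeShiftLG (G := G) t U) ∂μ) - (∫ U, A (Summit.QuantumFields.YangMills.Theorems.WeakCouplingRates.timeReflectLG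 U) ∂μ) * (∫ U, B (Summit.QuantumFields.YangMills.Theorems.WeakCouplingRates.timeShiftLG (G := G) t U) ∂μ)| ≤ 2 * Real.exp (-(m * t)) * a * b

/-- item stmt-QuantumFields-23209 · support · rank 3 · closed · proved by Summit.QuantumFields.YangMills.Theorems.SteinGapBootstrap.GapGivesClusteringGR_proof (prover) · by planner
why it might fail: Not expected to fail: proved for 0 ≤ β (gapGivesClusteringG_of_nonneg, p578815: time-zero site-RP of torus-limit states + CS on the RP form); only a mismatch between this verbatim text and that theorem's statement could bite.
sources: p578815
[crux] REPAIRED K2 (supersedes GapGivesClusteringG, stmt-QuantumFields-22999, misstated by `∀ β :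
ℝ`): for every compact simple G, faithful unitary r, every β ≥ 0, every torus-limit state μ (d = 4)
and every m with `HasRPTimeGap μ m`: positive-time observables A, B bounded by a, b cluster at rate
m, |∫A(θU)B(τ_t U)dμ − ∫A∘θ dμ ∫B∘τ_t dμ| ≤ 2e^(−mt)·a·b (time-zero site reflection positivity of
every torus-limit state at β ≥ 0 + Cauchy–Schwarz on the RP form + the one-sided gap at even times;
factor 1 in fact). PROVED verbatim in the tree:
`Summit.QuantumFields.YangMills.Theorems.SteinGapBootstrap.gapGivesClusteringG_of_nonneg` (p578815)
— closes by the one-line `theorem … : GapGivesClusteringGR := gapGivesClusteringG_of_nonneg`. [deps: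
none] [difficulty: provable-now] -/
@[route_item "route-QuantumFields-SteinGapBootstrap", crux]
def GapGivesClusteringGR : Prop :=
  ∀ (G : Type) [Group G] [TopologicalSpace G] [IsTopologicalGroup G] [CompactSpace G], Literature.MathematicalPhysics.QuantumFieldTheory.IsCompactSimpleLieGroup G → letI : MeasurableSpace G := borel G; haveI : BorelSpace G := ⟨rfl⟩; ∀ r : Literature.MathematicalPhysics.QuantumFieldTheory.LatticeRep G, ∀ β : ℝ, 0 ≤ β → ∀ μ ∈ Literature.MathematicalPhysics.QuantumLattice.infiniteVolumeLimitPoints (d := 4) r.ρ β, ∀ m : ℝ, Summit.QuantumFields.YangMills.Theorems.WeakCouplingRates.HasRPTimeGap μ m → ∀ (A B : Literature.MathematicalPhysics.QuantumLattice.LGConfig 4 (G) → ℝ), Summit.QuantumFields.YangMills.Theorems.WeakCouplingRates.IsPosTimeObs A → Summit.QuantumFields.YangMills.Theorems.WeakCouplingRates.IsPosTimeObs B → ∀ a b : ℝ, (∀ U, |A U| ≤ a) → (∀ U, |B U| ≤ b) → ∀ t : ℕ, |(∫ U, A (Summit.QuantumFields.YangMills.Theorems.WeakCouplingRates.timeReflectLG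 U) * B (Summit.QuantumFields.YangMills.Theorems.WeakCouplingRates.timeShiftLG (G := G) t U) ∂μ) - (∫ U, A (Summit.QuantumFields.YangMills.Theorems.WeakCouplingRates.timeReflectLG U) ∂μ) * (∫ U, B (Summit.QuantumFields.YangMills.Theorems.WeakCouplingRates.timeShiftLG (G := G) t U) ∂μ)| ≤ 2 * Real.exp (-(m * t)) * a * b

-- `GapGivesClusteringGR` holds: proved by `Summit.QuantumFields.YangMills.Theorems.SteinGapBootstrap.GapGivesClusteringGR_proof` (its module imports this route file, so no `_holds` link can be stated here).

/-- item stmt-QuantumFields-23000 · support · rank 9 · closed · proved by Summit.QuantumFields.YangMills.Theorems.SteinGapBootstrap.PolySmallFieldsG_proof (prover) · by planner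
sources: Chatterjee2016, arXiv:2511.07297, SeilerLNP1982
[support] Equipartition bound for limit states (every compact simple G, faithful unitary r): there
are C₀, β₀ with ∫(N − Re tr r(U_p))dμ ≤ C₀/β at every plaquette for every β ≥ β₀ and every
torus-limit state μ (from the tree's `FreeEnergyLogCoefficient_proof` — f(β) + (9/2)log β → K for
SU(2) — convexity / `SubgradientLogSqueeze`, and weak convergence of the bounded continuous
plaquette observable). [difficulty: provable-now] -/
@[route_item "route-QuantumFields-SteinGapBootstrap", crux]
def PolySmallFieldsG : Prop :=
  ∀ (G : Type) [Group G] [TopologicalSpace G] [IsTopologicalGroup G] [CompactSpace G], Literature.MathematicalPhysics.QuantumFieldTheory.IsCompactSimpleLieGroup G → letI : MeasurableSpace G := borel G; haveI : BorelSpace G := ⟨rfl⟩; ∀ r : Literature.MathematicalPhysics.QuantumFieldTheory.LatticeRep G, ∃ C₀ β₀ : ℝ, ∀ β : ℝ, β₀ ≤ β → ∀ μ ∈ Literature.MathematicalPhysics.QuantumLattice.infiniteVolumeLimitPoints (d := 4) r.ρ β, ∀ (x : Literature.Probability.LatticeModels.Site 4) (i j : Fin 4), i ≠ j → ∫ U,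 ((r.N : ℝ) - Literature.MathematicalPhysics.QuantumLattice.plaquetteObs r.ρ x i j U) ∂μ ≤ C₀ / β

-- `PolySmallFieldsG` holds: proved by `Summit.QuantumFields.YangMills.Theorems.SteinGapBootstrap.PolySmallFieldsG_proof` (its module imports this route file, so no `_holds` link can be stated here).

/-- item stmt-QuantumFields-23001 · support · rank 9 · closed · proved by Summit.QuantumFields.YangMills.Theorems.SteinGapBootstrap.axisSymmetryG_proof (prover) · by planner
sources: SeilerLNP1982, OsterwalderSeilerAnnPhys1978
[support] Every torus-limit state is invariant, on bounded continuous cylinder observables, under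
the coordinate permutations `relabelConfig (edgePerm σ)` (the symmetric tori Λ_(L+1)⁴ and the Wilson
action are hypercubic-invariant; pass to the limit exactly as the tree's B-TI
`integral_comp_configShift_of_mem_limitPoints` does for translations). [difficulty: provable-now] -/
@[route_item "route-QuantumFields-SteinGapBootstrap", crux]
def AxisSymmetryG : Prop :=
  ∀ (G : Type) [Group G] [TopologicalSpace G] [IsTopologicalGroup G] [CompactSpace G], Literature.MathematicalPhysics.QuantumFieldTheory.IsCompactSimpleLieGroup G → letI : MeasurableSpace G := borel G; haveI : BorelSpace G := ⟨rfl⟩; ∀ r : Literature.MathematicalPhysics.QuantumFieldTheory.LatticeRep G, ∀ β : ℝ, ∀ μ ∈ Literature.MathematicalPhysics.QuantumLattice.infiniteVolumeLimitPoints (d := 4) r.ρ β, ∀ (σ : Equiv.Perm (Fin 4)) (F : Literature.MathematicalPhysics.QuantumLattice.LGConfig 4 (G) → ℝ) (S : Finset (Literature.MathematicalPhysics.QuantumLattice.ZdEdge 4)), Literature.MathematicalPhysics.QuantumLattice.IsCylinder F S → Continuous F → (∃ C, ∀ U, |F U| ≤ C) → ∫ U, F (Literature.MathematicalPhysics.QuantumLattice.relabelConfig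 (Literature.MathematicalPhysics.QuantumLattice.edgePerm σ) U) ∂μ = ∫ U, F U ∂μ

-- `AxisSymmetryG` holds: proved by `Summit.QuantumFields.YangMills.Theorems.SteinGapBootstrap.axisSymmetryG_proof` (its module imports this route file, so no `_holds` link can be stated here).

/-- item stmt-QuantumFields-23210 · crux (kind.auto-crux: conjecture-grade) · rank 1 · closed · proved by Summit.QuantumFields.YangMills.Theorems.SteinGapBootstrap.AssemblyR_proof (prover) · by planner
why it might fail: auto-crux — conjecture-grade statement (statement references the registered conjecture Summit.QuantumFields.YangMills.Theorems.WeakCouplingRates.XiPow); it is open, so it may simply be false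
sources: ChatterjeeYMProb2019, OsterwalderSeilerAnnPhys1978
[assembly] REPAIRED assembly (supersedes Assembly, stmt-QuantumFields-22997): SteinBlockTransferG →
GapGivesClusteringGR → PolySmallFieldsG → AxisSymmetryG → XiPow (the all-G leaf R2ξ′); the
xiDiv-pattern contradiction uses K2 only at β ≥ max(β₀,1). PROVED verbatim in the tree:
`Summit.QuantumFields.YangMills.Theorems.SteinGapBootstrap.xiPow_of_clustering_nonneg` (p581290) —
closes by a one-line term. [deps: SteinBlockTransferG, GapGivesClusteringGR, PolySmallFieldsG,
AxisSymmetryG] [difficulty: provable-now] -/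
@[route_item "route-QuantumFields-SteinGapBootstrap", crux]
def AssemblyR : Prop :=
  SteinBlockTransferG → GapGivesClusteringGR → PolySmallFieldsG → AxisSymmetryG → Summit.QuantumFields.YangMills.Theorems.WeakCouplingRates.XiPow

-- `AssemblyR` holds: proved by `Summit.QuantumFields.YangMills.Theorems.SteinGapBootstrap.AssemblyR_proof` (its module imports this route file, so no `_holds` link can be stated here).

/-- item stmt-QuantumFields-23908 · aside · rank 9 · closed · moot by None · by planner
why it might fail: Same as FreeProbeLawG at G = SU(2): the rate could fail if the free energy has no power-rate expansion (log-corrections at two loops would still give a rate; a genuinely non-power correction would not).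
sources: ChatterjeeYMProb2019, doi:10.1214/09-AOP467
[aside] U|(SU(2), fundamental) = FreeProbeLawG specialised to G := Matrix.specialUnitaryGroup (Fin
2) ℂ, r := fundamentalLatticeRep 2 (verbatim specialisation; planner bc/su2_case.lean proves
FreeProbeLawG → FreeProbeLawSU2 given SU(2) compact simple). BANKED CONTEXT, never staffed: it is
the tribunal's s_case / BC5 refutable instance — the leaf XiPow IS a theorem at (SU(2), fund)
(xiPowSU2_holds) while this two-sided RATE law is not, and it is falsifiable by lattice numerics at
moderate β (probe covariance vs g_D(n) = 2^(−3)((1 − c_n²)^(−3/2) − 1), D = 3). -/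
@[route_item "route-QuantumFields-SteinGapBootstrap"]
def FreeProbeLawSU2 : Prop :=
  letI : MeasurableSpace (Matrix.specialUnitaryGroup (Fin 2) ℂ) := borel (Matrix.specialUnitaryGroup (Fin 2) ℂ); haveI : BorelSpace (Matrix.specialUnitaryGroup (Fin 2) ℂ) := ⟨rfl⟩; ∀ C₀ : ℝ, ∃ (K δ C β₀ : ℝ), 0 < δ ∧ 0 < C ∧ ∀ β : ℝ, β₀ ≤ β → ∀ μ ∈ Literature.MathematicalPhysics.QuantumLattice.infiniteVolumeLimitPoints (d := 4) (Literature.MathematicalPhysics.QuantumLattice.fundamentalLatticeRep 2).ρ β, (∀ (x : Literature.Probability.LatticeModels.Site 4) (i j : Fin 4), i ≠ j → ∫ U, (((Literature.MathematicalPhysics.QuantumLattice.fundamentalLatticeRep 2).N : ℝ) - Literature.MathematicalPhysics.QuantumLattice.plaquetteObs (Literature.MathematicalPhysics.QuantumLattice.fundamentalLatticeRep 2).ρ x i j U) ∂μ ≤ C₀ / β) → (∀ (σ : Equiv.Perm (Fin 4)) (F : Literature.MathematicalPhysics.QuantumLattice.LGConfig 4 (Matrix.specialUnitaryGroup (Fin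 2) ℂ) → ℝ) (S : Finset (Literature.MathematicalPhysics.QuantumLattice.ZdEdge 4)), Literature.MathematicalPhysics.QuantumLattice.IsCylinder F S → Continuous F → (∃ C, ∀ U, |F U| ≤ C) → ∫ U, F (Literature.MathematicalPhysics.QuantumLattice.relabelConfig (Literature.MathematicalPhysics.QuantumLattice.edgePerm σ) U) ∂μ = ∫ U, F U ∂μ) → ∀ n : ℕ, 1 ≤ n → let P : Literature.MathematicalPhysics.QuantumLattice.LGConfig 4 (Matrix.specialUnitaryGroup (Fin 2) ℂ) → ℝ := fun U => Real.exp (-2 * max (β * (((Literature.MathematicalPhysics.QuantumLattice.fundamentalLatticeRep 2).N : ℝ) - Literature.MathematicalPhysics.QuantumLattice.plaquetteObs (Literature.MathematicalPhysics.QuantumLattice.fundamentalLatticeRep 2).ρ 0 1 2 U)) 0); let D : ℝ := (Module.finrank ℝ ↥(Submodule.span ℝ {X : Matrix (Fin (Literature.MathematicalPhysics.QuantumLattice.fundamentalLatticeRep 2).N) (Fin (Literature.MathematicalPhysics.QuantumLattice.fundamentalLatticeRep 2).N) ℂ | ∀ t : ℝ, NormedSpace.exp ((t : ℂ) • X) ∈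 Set.range (Literature.MathematicalPhysics.QuantumLattice.fundamentalLatticeRep 2).ρ}) : ℝ); let c₂ : ℝ := Literature.MathematicalPhysics.QuantumFieldTheory.curvaturePlaquetteCorr (d := 4) (by norm_num) (n : ℤ); |((∫ U, P U * P (Summit.QuantumFields.YangMills.Theorems.WeakCouplingRates.timeShiftLG (G := Matrix.specialUnitaryGroup (Fin 2) ℂ) n U) ∂μ) - (∫ U, P U ∂μ) * (∫ U, P (Summit.QuantumFields.YangMills.Theorems.WeakCouplingRates.timeShiftLG (G := Matrix.specialUnitaryGroup (Fin 2) ℂ) n U) ∂μ)) - (2 : ℝ) ^ (-D) * ((1 - c₂ ^ 2) ^ (-(D / 2)) - 1)| ≤ C * (1 + (n : ℝ)) ^ K * β ^ (-δ)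

-- earlier Assembly (stmt-QuantumFields-22183, replaced 2026-08-27T21:53:52Z -> stmt-QuantumFields-22997): retired by None — SteinBlockTransfer → GapGivesClustering → PolySmallFields → AxisSymmetry → Summit.QuantumFields.YangMills.Theorems.WeakCouplingRates.XiPowSU2
/-- item stmt-QuantumFields-22997 · assembly · rank 1 · closed · proved by Summit.QuantumFields.YangMills.Theorems.SteinGapBootstrap.Assembly_proof (prover) · by planner
sources: ChatterjeeYMProb2019, OsterwalderSeilerAnnPhys1978
[assembly] SteinBlockTransferG → GapGivesClusteringG → PolySmallFieldsG → AxisSymmetryG → XiPow (the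
all-G leaf R2ξ′). -/
@[route_item "route-QuantumFields-SteinGapBootstrap"]
def Assembly : Prop :=
  SteinBlockTransferG → GapGivesClusteringG → PolySmallFieldsG → AxisSymmetryG → Summit.QuantumFields.YangMills.Theorems.WeakCouplingRates.XiPow

-- `Assembly` holds: proved by `Summit.QuantumFields.YangMills.Theorems.SteinGapBootstrap.Assembly_proof` (its module imports this route file, so no `_holds` link can be stated here).

/-! D-0027 §2.1 — DECIDING THEOREM (planner-authored via `route open/edit --closes-file`; by planner-ym-idea-4-g2-0 2026-08-27T23:46:13Z) — ARCHIVED: route closed (superseded) 2026-08-28T01:35:52Z; kept so importers keep building: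
its hypotheses are this route's items and its conclusion the registered leaf `Summit.QuantumFields.YangMills.Theorems.WeakCouplingRates.XiPow` (rung R2xi, D-0061) (glue_lint), and it elaborates with this file. -/

@[closes "route-QuantumFields-SteinGapBootstrap"] theorem closes (hU : FreeProbeLawG) (h₂ : GapGivesClusteringGR) (h₃ : PolySmallFieldsG) (h₄ : AxisSymmetryG)
    (h₅ : AssemblyR) : Summit.QuantumFields.YangMills.Theorems.WeakCouplingRates.XiPow := by
  -- U ⇒ K1 (the unconditional rate law dominates the conditional one), then the landed assembly.
  have hK1 : SteinBlockTransferG := by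
    intro G _ _ _ _ hG r C₀
    obtain ⟨K, δ, C, β₀, hδ, hC, H⟩ := hU G hG r C₀
    refine ⟨max K 0, δ, C, max β₀ 1, hδ, hC, ?_⟩
    intro β hβ μ hμ hi hii m hm hiii n hn
    have hβ₀ : β₀ ≤ β := le_trans (le_max_left _ _) hβ
    have hβ1 : 1 ≤ β := le_trans (le_max_right _ _) hβ
    refine le_trans (H β hβ₀ μ hμ hi hii n hn) ?_
    have hn0 : (0 : ℝ) ≤ (n : ℝ) := by positivity
    have hm0 : (0 : ℝ) ≤ m⁻¹ := le_of_lt (inv_pos.2 hm)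
    have hx1 : (1 : ℝ) ≤ 1 + (n : ℝ) := by linarith
    have hxy : 1 + (n : ℝ) ≤ 1 + m⁻¹ + (n : ℝ) := by linarith
    have h1 : (1 + (n : ℝ)) ^ K ≤ (1 + (n : ℝ)) ^ (max K 0) :=
      Real.rpow_le_rpow_of_exponent_le hx1 (le_max_left _ _)
    have h2 : (1 + (n : ℝ)) ^ (max K 0) ≤ (1 + m⁻¹ + (n : ℝ)) ^ (max K 0) :=
      Real.rpow_le_rpow (by linarith) hxy (le_max_right _ _)
    have hb : 0 ≤ β ^ (-δ) := le_of_lt (Real.rpow_pos_of_pos (by linarith) _)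
    exact mul_le_mul_of_nonneg_right (mul_le_mul_of_nonneg_left (le_trans h1 h2) (le_of_lt hC)) hb
  exact h₅ hK1 h₂ h₃ h₄

end Summit.QuantumFields.YangMills.Theses.SteinGapBootstrap
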